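import Summits.QuantumFields.BalabanUV.Beta.GAN24.BlockFluxRegion
import Summits.QuantumFields.BalabanUV.Beta.GAN24.SrecBornSector
import Summits.QuantumFields.BalabanUV.Beta.KernelWardMColumn
import Summits.QuantumFields.BalabanUV.Beta.ChartConjugationReflection

/-!
# `BalabanUV.Beta.GAN24.BlockFluxTower` — binder row G-an2-4 ∕ (CONV-C), CT-W (route «WC-TL» ∕ (Q-R) «QR-LL», located scalar K-LL-4′): **THE FLUX TOWER IS
# KERNEL-ONLY** — along the `k`-fold transport of the S-slot maps `S ↦ c_j • e3OfK N K_j S`, the flux of the transported letter through ANY finite set `T` of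
# level-`(m+k)` labels is the `k`-fold transport of the KERNEL-ONLY maps `V ↦ −((c_j·c_{H,j}) • mmRead N (K_j ∘ V ∘ K_j))` applied to the bottom letter's flux
# through the `N^k`-refinement of `T`; its entries contract ∕ grow by the PRODUCT of the per-level kernel-only gains — NO table leg, NO layer count at any level
# (the OWNER gan24-p1 g29's RULING R-gan24p1-g29-1 A1 «`Φ_{j+1} = ρ_Φ·Φ_j` … `ρ_Φ := c_H ×` (the `Φ ↦ mmRead(KΦK)` gain) — a KERNEL-ONLY scalar», iterated and
# TYPED; sequel of `GAN24/BlockFluxRegion` (mine, re-based on the OWNER's block law `GAN24/BoundaryFluxRecursion`); G-an2-4 formalisation swarm → CRUX TEAM (2), leaf prover `b2b-balaban-gan24-formalise-leaf-03`, gen 62, programme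
# «FLUX-REC» PART 2; module name PROVISIONAL — the row owner gan24-p1 may rename ∕ re-home it)

NOT IN PRINT; OUR BOOKKEEPING.  HONEST FRAMING (cell contract, verbatim): «discharging `BetaPertH` makes Bałaban's UV stability
UNCONDITIONAL — a real constructive-QFT result; it is NOT the continuum limit and NOT the Clay problem.»  HONEST DEPENDENCY (verbatim):
«continuum YM on T⁴ ⇐ BetaPertH ∧ nine spine estimates (0/9 proved); BetaPertH ⇐ (D1) ∧ (D4) ∧ CAP+tail; G-an2-4 gates asym, D1 and
NE2/3/4.»

WHAT ([folklore] kernel algebra BY NAME over PART 1 `BlockFluxRegion` (`regionSum_divV_e3OfK`, `abs_regionSum_divV_e3OfK_le`), leaf-01's `AffineUnroll.transport`,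
p2 g37's `WardResidualSUnroll` (`bdd_e3OfK`, `sum_box_one`), my g61 `LayerLetterUnion.biUnion_box_image_eq`, my g58 `E3SlotDivergence` (`divV_smul_family`, `e3K_eq_e3OfK`);
for ANY sequence of decaying packed kernels `K_j` (rates `δ_j > 0`), blocking `N ≥ 1`, scalars `c_j`, a bounded bottom letter `S`, UNDER (hH)_j with constants `c_{H,j}` —
DISCHARGED for the comb ∕ wall instances of §3; generic `d`; 0 `def`, 0 cite, 0 `def … : Prop`, 0 sorry).  Fluxes and refinements are written out as in PART 1
(`Σ_{u ∈ R} divV S u`; `U_M(T) := T.biUnion (Y ↦ (box (d+1) M).image (v ↦ M•Y + toSite v))`).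
* §1 `divV_finset_sum` ∕ `finsetSum_divV_finset_sum` (fluxes are additive over finite sums of letters — the END's Duhamel sum splits into towers),
  `exists_bdd_transport` (the tower stays in the bounded class), **`regionSum_divV_transport`** — for every `m, k` and every finite `T`:
  `Σ_{Y ∈ T} divV (transport 𝔖 m k S) Y = transport 𝔉 m k (Σ_{u ∈ U_{N^k}(T)} divV S u)`,
  `𝔖_j S := c_j • e3OfK N K_j S`, `𝔉_j V := −((c_j·c_{H,j}) • mmRead N (K_j ∘ V ∘ K_j))` (induction on `k`: PART 1 at the top level on the region `T`, the hypothesis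
  on the refined region `U_N(T)`, and `U_{N^k}(U_N(T)) = U_{N^{k+1}}(T)`); `regionSum_divV_transport_of_exists` (decay constants existential per level).
* §2 **`abs_regionSum_divV_transport_le`** — if the bottom flux through `U_{N^k}(T)` has entries `≤ B_Φ`, the transported letter's flux through `T` has entries
  `≤ (∏_{i<k} g_{m+i})·B_Φ`, `g_j := |c_j·c_{H,j}|·|Fib d|²·(C_j Z_{δ_j})²` — THE `k`-FOLD FLUX FACTOR IS A PRODUCT OF KERNEL-ONLY SCALARS (the RULING's `ρ_Φ^k`, as an
  upper bound in whatever units the `K_j` carry); `bdd_transport_of_gain` ∕ **`bdd_regionSum_divV_transport_of_gain`** — the same with an ABSTRACT per-level `Bdd`-gain `g_j`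
  (the socket for other currencies, e.g. leaf-01 g67's support-weighted `BoundaryFluxFaceCount`).
* §3 INSTANCES BY NAME: `unitStepMap_eq_smul_e3OfK` (an2 ∕ the OWNER's `SrecBornSector.unitStepMap Lc ρ cE j S = (cE·Lc^{2(d+1)}) • e3OfK Lc K♮ᴱ_j S`,
  `K♮ᴱ_j = unitK (sfStep Lc j) (smStep d Lc j) (coDressKBmAt ρ Lc (KInvStep Lc j))` — `KStepUnit_eq` ⨾ `unitK_coDressKBmAt` ⨾ `e3K_eq_e3OfK`), `stepMap_eq_smul_e3OfK`;
  **`regionSum_divV_transport_unitStepMap`** — the flux tower of the transport the (Q-R) END `WardRemainderEndThreeSplit` consumes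
  (`transport (unitStepMap Lc (toSite rr) cE) m k`): per-level flux map `V ↦ −((cE·Lc^{2(d+1)}·(Lc^{d+1})⁻¹) • mmRead Lc (K♮ᴱ_j ∘ V ∘ K♮ᴱ_j))` with the `j`-FREE scalar
  (`hH_unitK_comb`); **`regionSum_divV_transport_stepMap`** — the same in native units (`stepMap`: scalar `cE·wE (j+1)`, native `c_H(j) = (stepScale·Lc^{d+1})⁻¹` by
  d1-leaf-07's `colH_ward_KInvStep_all`); `regionSum_divV_unitStepMap` ∕ `regionSum_divV_stepMap` (one level); **`regionSum_divV_bornSecAt_succ`** — an2's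
  (REP) remainder `bornSecAt` (born sectors + level maps) obeys the AFFINE flux recursion: the flux of member `j+1` through `T` = the kernel-only map of level `j` on
  member `j`'s flux through `U_{Lc}(T)` + the flux of the fresh sources `freshAt (j+1)` through `T` — the OWNER's (D) «`g^{(j+1)}(Y) = −c_H • mmRead(K_j ∘ Σ g^{(j)} ∘ K_j)
  + divV σ_j(Y)`» by name.

Asserts NO size of any `g_j` against the END's designed rate `Lc^{−1/2}` (the constants `C_j, δ_j` of `K♮ᴱ_j` stay DISPLAYED per level); decides nothing about (Q-R) ∕
(DIV) ∕ the (Q-R)^{cc} re-cut; NOT the slot-side charge reset (L3); discharges NOTHING of «T2Shape» ∕ «T2Drift» ∕ (hW, hWall) ∕ (LT) ∕ (LAY) ∕ (S); 0 wall binders;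
NEVER «G-an2-4 closed» as (CONV-C); NOT D1, NOT `BetaPertH`, NOT continuum, NOT Clay; not in print — our bookkeeping.  Unit `b2b-balaban-gan24-formalise-leaf-03`
(gen 62), 2026-08-22.
-/

noncomputable section

open Finset
open scoped BigOperators
open Literature.MathematicalPhysics.QuantumFieldTheory
open Literature.MathematicalPhysics.QuantumFieldTheory.Balaban1983to89
open Literature.MathematicalPhysics.QuantumFieldTheory.Balaban1983to89.Beta
open B6BondElimination (unitVec)
open ExpKernelCalculus (MKer Site Decays comp Zl)
open OneStepResolventKernel (Fib)
open OneStepKernelFamily (colH KInvStep)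
open BalabanStepJetsSucc (mmRead wE)
open KernelWard (divV Bdd)
open AffineAveraging (box toSite)
open Summit.QuantumFields.BalabanUV.Beta.KernelWardRelative (gaugeWt)
open Summit.QuantumFields.BalabanUV.Beta.SpineRooted (e3OfK)
open Summit.QuantumFields.BalabanUV.Beta.WardLocusCubic (e3K)
open Summit.QuantumFields.BalabanUV.Beta.BorderedHessian (stepScale)
open Summit.QuantumFields.BalabanUV.Beta.GAN24.AffineUnroll (transport transport_zero transport_succ)
open Summit.QuantumFields.BalabanUV.Beta.GAN24.WardResidualSUnroll (bdd_e3OfK sum_box_one)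
open Summit.QuantumFields.BalabanUV.Beta.GAN24.E3SlotDivergence (divV_smul_family e3K_eq_e3OfK)
open Summit.QuantumFields.BalabanUV.Beta.GAN24.GaugeReadLayerForm (sum_sum_box_eq_sum_biUnion)
open Summit.QuantumFields.BalabanUV.Beta.GAN24.LayerLetterUnion (biUnion_box_image_eq)
open Summit.QuantumFields.BalabanUV.Beta.GAN24.BlockFluxRegion (regionSum_divV_e3OfK abs_regionSum_divV_e3OfK_le)
open Summit.QuantumFields.BalabanUV.Beta.GAN24.Lin4SlotDivergence (hH_unitK_comb)
open Summit.QuantumFields.BalabanUV.Beta.GAN24.SrecBornSector (stepMap unitStepMap freshAt bornSecAt_succ_eq)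
open Summit.QuantumFields.BalabanUV.Beta.GAN24.SrecWilsonSector (bornSecAt locStencil_bornSecAt)
open Summit.QuantumFields.BalabanUV.Beta.ChartConjugationReflection (abs_le_of_locStencil)
open Summit.QuantumFields.BalabanUV.Beta.KernelWardMColumn (divV_add)
open Summit.QuantumFields.BalabanUV.Beta.GAN24.SrecUnits (KStepUnit_eq)
open Summit.QuantumFields.BalabanUV.Beta.HessKerCoDressedBmWall (unitK_coDressKBmAt)
open Summit.QuantumFields.BalabanUV.Beta.KernelWardHColumnWall (colH_ward_KInvStep_all)
open Summit.QuantumFields.BalabanUV.Beta.HessKerDressedUnits (unitK decays_unitK)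
open Summit.QuantumFields.BalabanUV.Beta.GAN24.CombesThomas (sfStep smStep KStepUnit sfStep_ne_zero smStep_ne_zero)
open Summit.QuantumFields.BalabanUV.Beta.AxialDressingRooted (coDressKBmAt one_le_of_neZero decays_coDressKBmAt_KInvStep)

namespace Summit.QuantumFields.BalabanUV.Beta.GAN24.BlockFluxTower

variable {d N : ℕ}

/-! ## §1 The flux tower: `k` pushes, any region -/

section Tower

variable {K : ℕ → MKer (d + 1) (Fib d)} {C δ : ℕ → ℝ} {c cH : ℕ → ℝ}
  {S : Fin (d + 1) → (Fin (d + 1) → ℤ) → MKer (d + 1) (Fib d)} {B : ℝ}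

/-- [folklore] **FLUXES ARE ADDITIVE OVER FINITE SUMS OF LETTERS** (so the flux of the END's Duhamel sum `Φ_n(Y) = transport 0 n S + Σ_m transport (m+1) (n−1−m) σ_m`
through any region is the sum of the towers' fluxes, each governed by `regionSum_divV_transport`): `divV (Σ_{i ∈ s} F i) y = Σ_{i ∈ s} divV (F i) y`. -/
theorem divV_finset_sum {ι : Type*} (s : Finset ι) (F : ι → Fin (d + 1) → (Fin (d + 1) → ℤ) → MKer (d + 1) (Fib d)) (y : Fin (d + 1) → ℤ) :
    divV (∑ i ∈ s, F i) y = ∑ i ∈ s, divV (F i) y := by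
  simp only [KernelWard.divV, Finset.sum_apply, Finset.sum_sub_distrib]
  congr 1 <;> exact Finset.sum_comm

/-- [folklore] … and over finite sums of regions' worth of letters: the flux of a finite sum of letters through a finite set of labels. -/
theorem finsetSum_divV_finset_sum {ι : Type*} (s : Finset ι) (F : ι → Fin (d + 1) → (Fin (d + 1) → ℤ) → MKer (d + 1) (Fib d))
    (T : Finset (Site (d + 1))) :
    ∑ Y ∈ T, divV (∑ i ∈ s, F i) Y = ∑ i ∈ s, ∑ Y ∈ T, divV (F i) Y := by
  rw [Finset.sum_comm]
  exact Finset.sum_congr rfl fun Y _ => divV_finset_sum s F Y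

/-- [folklore] **THE TOWER STAYS IN THE BOUNDED CLASS**: every transported letter `transport (j S ↦ c_j • e3OfK N K_j S) m k S` of a bounded letter along decaying
kernels has uniformly bounded entries (p2's `bdd_e3OfK`, level by level). -/
theorem exists_bdd_transport (hK : ∀ j, Decays (K j) (C j) (δ j)) (hδ : ∀ j, 0 < δ j) (c : ℕ → ℝ) (N : ℕ)
    (hS : ∀ κ u x z a b, |S κ u x z a b| ≤ B) (m : ℕ) :
    ∀ k : ℕ, ∃ B' : ℝ, ∀ κ u x z a b, |transport (fun j S => c j • e3OfK N (K j) S) m k S κ u x z a b| ≤ B'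
  | 0 => ⟨B, fun κ u x z a b => by rw [transport_zero]; exact hS κ u x z a b⟩
  | k + 1 => by
    obtain ⟨B', hB'⟩ := exists_bdd_transport hK hδ c N hS m k
    refine ⟨|c (m + k)| * ((Fintype.card (Fib d) : ℝ) * ((Fintype.card (Fib d) : ℝ) *
      (C (m + k) * Zl (d + 1) (δ (m + k)) * (((d + 1 : ℕ) : ℝ) * (C (m + k) * Zl (d + 1) (δ (m + k)) * B')))
        * (C (m + k) * Zl (d + 1) (δ (m + k))))), fun κ u x z a b => ?_⟩
    simp only [transport_succ, Pi.smul_apply, smul_eq_mul, abs_mul]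
    exact mul_le_mul_of_nonneg_left (bdd_e3OfK (hK (m + k)) (hδ (m + k)) N hB' κ u x z a b) (abs_nonneg _)

/-- [folklore] **THE FLUX TOWER IS KERNEL-ONLY** (the OWNER's A1 recursion, iterated): for decaying kernels `K_j` (rates `δ_j > 0`), `N ≥ 1`, scalars `c_j`, a bounded
bottom letter `S`, (hH)_j with constants `c_{H,j}`, every `m, k` and EVERY finite set `T` of level-`(m+k)` labels,
`Σ_{Y ∈ T} divV (transport 𝔖 m k S) Y = transport 𝔉 m k (Σ_{u ∈ ⋃_{Y∈T} (N^k•Y + box N^k)} divV S u)`,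
`𝔖_j S := c_j • e3OfK N K_j S`, `𝔉_j V := −((c_j·c_{H,j}) • mmRead N (K_j ∘ V ∘ K_j))` — the transported letter's flux through `T` is a NESTED RESOLVENT SANDWICH of the
bottom letter's flux through the `N^k`-refinement of `T`: no table leg and no layer count at any level. -/
theorem regionSum_divV_transport (hK : ∀ j, Decays (K j) (C j) (δ j)) (hδ : ∀ j, 0 < δ j) (hN : 1 ≤ N)
    (hS : ∀ κ u x z a b, |S κ u x z a b| ≤ B)
    (hH : ∀ (j : ℕ) (y : Fin (d + 1) → ℤ) (κ' : Fin (d + 1)) (u : Fin (d + 1) → ℤ),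
      ∑ μ, (colH (K j) N μ (y - unitVec μ) κ' u - colH (K j) N μ y κ' u) = cH j * gaugeWt N y κ' u)
    (m : ℕ) : ∀ (k : ℕ) (T : Finset (Site (d + 1))),
    ∑ Y ∈ T, divV (transport (fun j S => c j • e3OfK N (K j) S) m k S) Y
      = transport (fun j V => -((c j * cH j) • mmRead N (comp (comp (K j) V) (K j)))) m k
          (∑ u ∈ T.biUnion (fun Y => (box (d + 1) (N ^ k)).image (fun v => ((N ^ k : ℕ) : ℤ) • Y + toSite v)), divV S u)
  | 0, T => by
    rw [transport_zero, transport_zero, ← sum_sum_box_eq_sum_biUnion T (divV S)]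
    simp only [pow_zero]
    exact Finset.sum_congr rfl fun Y _ => (sum_box_one (divV S) Y).symm
  | k + 1, T => by
    classical
    obtain ⟨B', hB'⟩ := exists_bdd_transport hK hδ c N hS m k
    have hNk : 1 ≤ N ^ k := Nat.one_le_pow _ _ (Nat.pos_of_ne_zero (Nat.one_le_iff_ne_zero.1 hN))
    have ih := regionSum_divV_transport hK hδ hN hS hH m k
      (T.biUnion (fun Y => (box (d + 1) N).image (fun v => (N : ℤ) • Y + toSite v)))
    -- refining the refined region: `U_{N^k}(U_N(T)) = U_{N^{k+1}}(T)`
    have e2 : (T.biUnion (fun Y => (box (d + 1) N).image (fun v => (N : ℤ) • Y + toSite v))).biUnion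
          (fun Y' => (box (d + 1) (N ^ k)).image (fun v => ((N ^ k : ℕ) : ℤ) • Y' + toSite v))
        = T.biUnion (fun Y => (box (d + 1) (N ^ (k + 1))).image (fun s => ((N ^ (k + 1) : ℕ) : ℤ) • Y + toSite s)) := by
      rw [Finset.biUnion_biUnion]
      refine Finset.biUnion_congr rfl fun Y _ => ?_
      rw [pow_succ]
      exact biUnion_box_image_eq hNk N Y
    -- the top level: PART 1 on the region `T`, then the hypothesis on `U_N(T)`
    have e1 : ∑ Y ∈ T, divV (c (m + k) • e3OfK N (K (m + k)) (transport (fun j S => c j • e3OfK N (K j) S) m k S)) Y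
        = c (m + k) • ∑ Y ∈ T, divV (e3OfK N (K (m + k)) (transport (fun j S => c j • e3OfK N (K j) S) m k S)) Y := by
      rw [Finset.smul_sum]
      exact Finset.sum_congr rfl fun Y _ => divV_smul_family _ _ Y
    simp only [transport_succ]
    rw [e1, regionSum_divV_e3OfK (hK (m + k)) (hδ (m + k)) hN hB' (hH (m + k)) _, ih, e2, smul_neg, smul_smul]

/-- [folklore] The same with the kernels' decay constants existential per level (`∀ j, ∃ δ C, 0 < δ ∧ Decays K_j C δ` — the tree's form for the comb resolvents). -/
theorem regionSum_divV_transport_of_exists (hK : ∀ j, ∃ δ C : ℝ, 0 < δ ∧ Decays (K j) C δ) (hN : 1 ≤ N)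
    (hS : ∀ κ u x z a b, |S κ u x z a b| ≤ B)
    (hH : ∀ (j : ℕ) (y : Fin (d + 1) → ℤ) (κ' : Fin (d + 1)) (u : Fin (d + 1) → ℤ),
      ∑ μ, (colH (K j) N μ (y - unitVec μ) κ' u - colH (K j) N μ y κ' u) = cH j * gaugeWt N y κ' u)
    (m k : ℕ) (T : Finset (Site (d + 1))) :
    ∑ Y ∈ T, divV (transport (fun j S => c j • e3OfK N (K j) S) m k S) Y
      = transport (fun j V => -((c j * cH j) • mmRead N (comp (comp (K j) V) (K j)))) m k
          (∑ u ∈ T.biUnion (fun Y => (box (d + 1) (N ^ k)).image (fun v => ((N ^ k : ℕ) : ℤ) • Y + toSite v)), divV S u) := by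
  choose δ' C' hδ' hK' using hK
  exact regionSum_divV_transport hK' hδ' hN hS hH m k T

/-! ## §2 The `k`-fold flux factor is a product of kernel-only scalars -/

/-- [folklore] **THE `k`-FOLD FLUX FACTOR** (the RULING's `ρ_Φ^k`, as an upper bound): if the bottom letter's flux through `U_{N^k}(T)` has entries `≤ B_Φ`, then
`|(Σ_{Y ∈ T} divV (transport 𝔖 m k S) Y) x z a b| ≤ (∏_{i<k} g_{m+i})·B_Φ`, `g_j := |c_j·c_{H,j}|·(|Fib d|·(|Fib d|·((C_j Z_{δ_j})·(C_j Z_{δ_j}))))` — each level contributes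
ONE kernel-only scalar, no table constant (PART 1's `abs_regionSum_divV_e3OfK_le` at the top, the hypothesis on the refined region).  LOCATED CAVEAT (leaf-01 g67 R-1,
adopted): sup → sup and SUPPORT-BLIND — in the END's `unitS` currency each `g_j` is `≍ Lc^{2d}`; the support-weighted count gives `Lc^{d−2}` per level (leaf-01's complement
`GAN24/BoundaryFluxFaceCount`); the SIZE of the true factor is not asserted here. -/
theorem abs_regionSum_divV_transport_le (hK : ∀ j, Decays (K j) (C j) (δ j)) (hδ : ∀ j, 0 < δ j) (hN : 1 ≤ N)
    (hS : ∀ κ u x z a b, |S κ u x z a b| ≤ B)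
    (hH : ∀ (j : ℕ) (y : Fin (d + 1) → ℤ) (κ' : Fin (d + 1)) (u : Fin (d + 1) → ℤ),
      ∑ μ, (colH (K j) N μ (y - unitVec μ) κ' u - colH (K j) N μ y κ' u) = cH j * gaugeWt N y κ' u)
    (m : ℕ) : ∀ (k : ℕ) (T : Finset (Site (d + 1))) (BΦ : ℝ),
    Bdd (∑ u ∈ T.biUnion (fun Y => (box (d + 1) (N ^ k)).image (fun v => ((N ^ k : ℕ) : ℤ) • Y + toSite v)), divV S u) BΦ →
    ∀ (x z : Fin (d + 1) → ℤ) (a b : Fib d),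
      |(∑ Y ∈ T, divV (transport (fun j S => c j • e3OfK N (K j) S) m k S) Y) x z a b|
        ≤ (∏ i ∈ Finset.range k, (|c (m + i) * cH (m + i)| * ((Fintype.card (Fib d) : ℝ) * ((Fintype.card (Fib d) : ℝ)
            * ((C (m + i) * Zl (d + 1) (δ (m + i))) * (C (m + i) * Zl (d + 1) (δ (m + i)))))))) * BΦ
  | 0, T, BΦ, hΦ, x, z, a, b => by
    rw [regionSum_divV_transport hK hδ hN hS hH m 0 T, transport_zero, Finset.prod_range_zero, one_mul]
    exact hΦ x z a b
  | k + 1, T, BΦ, hΦ, x, z, a, b => by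
    classical
    obtain ⟨B', hB'⟩ := exists_bdd_transport hK hδ c N hS m k
    have hNk : 1 ≤ N ^ k := Nat.one_le_pow _ _ (Nat.pos_of_ne_zero (Nat.one_le_iff_ne_zero.1 hN))
    have e2 : (T.biUnion (fun Y => (box (d + 1) N).image (fun v => (N : ℤ) • Y + toSite v))).biUnion
          (fun Y' => (box (d + 1) (N ^ k)).image (fun v => ((N ^ k : ℕ) : ℤ) • Y' + toSite v))
        = T.biUnion (fun Y => (box (d + 1) (N ^ (k + 1))).image (fun s => ((N ^ (k + 1) : ℕ) : ℤ) • Y + toSite s)) := by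
      rw [Finset.biUnion_biUnion]
      refine Finset.biUnion_congr rfl fun Y _ => ?_
      rw [pow_succ]
      exact biUnion_box_image_eq hNk N Y
    -- the hypothesis on the refined region (its `N^k`-refinement is the `N^{k+1}`-refinement of `T`)
    have ih : Bdd (∑ u ∈ T.biUnion (fun Y => (box (d + 1) N).image (fun v => (N : ℤ) • Y + toSite v)),
          divV (transport (fun j S => c j • e3OfK N (K j) S) m k S) u)
        ((∏ i ∈ Finset.range k, (|c (m + i) * cH (m + i)| * ((Fintype.card (Fib d) : ℝ) * ((Fintype.card (Fib d) : ℝ)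
            * ((C (m + i) * Zl (d + 1) (δ (m + i))) * (C (m + i) * Zl (d + 1) (δ (m + i)))))))) * BΦ) := by
      intro x z a b
      refine abs_regionSum_divV_transport_le hK hδ hN hS hH m k _ BΦ ?_ x z a b
      rw [e2]
      exact hΦ
    have e1 : ∑ Y ∈ T, divV (c (m + k) • e3OfK N (K (m + k)) (transport (fun j S => c j • e3OfK N (K j) S) m k S)) Y
        = c (m + k) • ∑ Y ∈ T, divV (e3OfK N (K (m + k)) (transport (fun j S => c j • e3OfK N (K j) S) m k S)) Y := by
      rw [Finset.smul_sum]
      exact Finset.sum_congr rfl fun Y _ => divV_smul_family _ _ Y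
    have htop := abs_regionSum_divV_e3OfK_le (hK (m + k)) (hδ (m + k)) hN hB' (hH (m + k)) T ih x z a b
    simp only [transport_succ]
    rw [e1, Pi.smul_apply, Pi.smul_apply, Pi.smul_apply, Pi.smul_apply, smul_eq_mul, abs_mul, Finset.prod_range_succ]
    refine (mul_le_mul_of_nonneg_left htop (abs_nonneg _)).trans (le_of_eq ?_)
    rw [abs_mul]
    ring

/-- [folklore] **ANY PER-LEVEL `Bdd`-GAIN MULTIPLIES UP ALONG THE TRANSPORT** (pure bookkeeping, the socket for other currencies — e.g. leaf-01 g67's support-weighted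
gain `BoundaryFluxFaceCount.bdd_smul_mmRead_sandwich_of_faceMass` with its face mass folded into `g_j`): if every level map `F_j` satisfies `Bdd V B → Bdd (F_j V) (g_j·B)`,
then `Bdd V B → Bdd (transport F m k V) ((∏_{i<k} g_{m+i})·B)`. -/
theorem bdd_transport_of_gain {F : ℕ → MKer (d + 1) (Fib d) → MKer (d + 1) (Fib d)} {g : ℕ → ℝ}
    (hgain : ∀ (j : ℕ) (V : MKer (d + 1) (Fib d)) (BV : ℝ), Bdd V BV → Bdd (F j V) (g j * BV)) (m : ℕ) :
    ∀ (k : ℕ) {V : MKer (d + 1) (Fib d)} {BV : ℝ}, Bdd V BV → Bdd (transport F m k V) ((∏ i ∈ Finset.range k, g (m + i)) * BV)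
  | 0, V, BV, hV => by rw [transport_zero, Finset.prod_range_zero, one_mul]; exact hV
  | k + 1, V, BV, hV => by
    rw [transport_succ, Finset.prod_range_succ, mul_comm (∏ i ∈ Finset.range k, g (m + i)) (g (m + k)), mul_assoc]
    exact hgain (m + k) _ _ (bdd_transport_of_gain hgain m k hV)

/-- [folklore] **THE `k`-FOLD FLUX BOUND WITH AN ABSTRACT PER-LEVEL GAIN**: if each kernel-only level map `V ↦ −((c_j·c_{H,j}) • mmRead N (K_j ∘ V ∘ K_j))` has `Bdd`-gain
`g_j` (in whatever currency the `g_j` were counted — `Decays` alone as in `abs_regionSum_divV_transport_le`, or support-weighted), and the bottom letter's flux through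
`U_{N^k}(T)` has entries `≤ B_Φ`, then the transported letter's flux through `T` has entries `≤ (∏_{i<k} g_{m+i})·B_Φ` (`regionSum_divV_transport` ⨾ `bdd_transport_of_gain`). -/
theorem bdd_regionSum_divV_transport_of_gain (hK : ∀ j, Decays (K j) (C j) (δ j)) (hδ : ∀ j, 0 < δ j) (hN : 1 ≤ N)
    (hS : ∀ κ u x z a b, |S κ u x z a b| ≤ B)
    (hH : ∀ (j : ℕ) (y : Fin (d + 1) → ℤ) (κ' : Fin (d + 1)) (u : Fin (d + 1) → ℤ),
      ∑ μ, (colH (K j) N μ (y - unitVec μ) κ' u - colH (K j) N μ y κ' u) = cH j * gaugeWt N y κ' u)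
    {g : ℕ → ℝ} (hgain : ∀ (j : ℕ) (V : MKer (d + 1) (Fib d)) (BV : ℝ),
      Bdd V BV → Bdd (-((c j * cH j) • mmRead N (comp (comp (K j) V) (K j)))) (g j * BV))
    (m k : ℕ) (T : Finset (Site (d + 1))) {BΦ : ℝ}
    (hΦ : Bdd (∑ u ∈ T.biUnion (fun Y => (box (d + 1) (N ^ k)).image (fun v => ((N ^ k : ℕ) : ℤ) • Y + toSite v)), divV S u) BΦ) :
    Bdd (∑ Y ∈ T, divV (transport (fun j S => c j • e3OfK N (K j) S) m k S) Y) ((∏ i ∈ Finset.range k, g (m + i)) * BΦ) := by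
  rw [regionSum_divV_transport hK hδ hN hS hH m k T]
  exact bdd_transport_of_gain (F := fun j V => -((c j * cH j) • mmRead N (comp (comp (K j) V) (K j)))) hgain m k hΦ

end Tower

/-! ## §3 Instances: the literal's level maps BY NAME -/

section Literal

variable {Lc : ℕ} [NeZero Lc] {rr : Fin (d + 1) → ℕ} {S : Fin (d + 1) → (Fin (d + 1) → ℤ) → MKer (d + 1) (Fib d)} {B : ℝ}

/-- [folklore] **THE LEVEL MAP IN THE ADOPTED UNITS IS A SCALED S-SLOT MAP OF THE NORMALISED CO-DRESSED STEP RESOLVENT**: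
`unitStepMap Lc ρ cE j S = (cE·Lc^{2(d+1)}) • e3OfK Lc K♮ᴱ_j S`, `K♮ᴱ_j = unitK (sfStep Lc j) (smStep d Lc j) (coDressKBmAt ρ Lc (KInvStep Lc j))`
(`KStepUnit_eq` ⨾ `unitK_coDressKBmAt` ⨾ `e3K_eq_e3OfK`). -/
theorem unitStepMap_eq_smul_e3OfK (ρ : Fin (d + 1) → ℤ) (cE : ℝ) :
    unitStepMap Lc ρ cE = fun j S => (cE * (Lc : ℝ) ^ (2 * (d + 1))) •
      e3OfK Lc (unitK (sfStep Lc j) (smStep d Lc j) (coDressKBmAt ρ Lc (KInvStep (d := d) Lc j))) S := by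
  funext j S κ' u'
  show (cE * (Lc : ℝ) ^ (2 * (d + 1))) • e3K (coDressKBmAt ρ Lc (KStepUnit (d := d) Lc j)) Lc S κ' u' = _
  rw [KStepUnit_eq, ← unitK_coDressKBmAt ρ Lc (sfStep_ne_zero j) (smStep_ne_zero j) (KInvStep (d := d) Lc j), e3K_eq_e3OfK]
  rfl

/-- [folklore] **THE NATIVE LEVEL MAP IS A SCALED S-SLOT MAP OF THE CO-DRESSED STEP RESOLVENT**: `stepMap Lc ρ cE j S = (cE·wE (j+1)) • e3OfK Lc (coDressKBmAt ρ Lc (KInvStep Lc j)) S`. -/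
theorem stepMap_eq_smul_e3OfK (ρ : Fin (d + 1) → ℤ) (cE : ℝ) :
    stepMap Lc ρ cE = fun j S => (cE * wE d Lc (j + 1)) • e3OfK Lc (coDressKBmAt ρ Lc (KInvStep (d := d) Lc j)) S := by
  funext j S κ' u'
  rfl

/-- [folklore] **ONE LEVEL OF THE LITERAL's TRANSPORT IN UNITS — THE FLUX RECURSION** (in-block root `rr`, bounded `S`, any `cE`, every finite `T`):
`Σ_{Y ∈ T} divV (unitStepMap Lc (toSite rr) cE j S) Y = −((cE·Lc^{2(d+1)}·(Lc^{d+1})⁻¹) • mmRead Lc (K♮ᴱ_j ∘ (Σ_{u ∈ U_{Lc}(T)} divV S u) ∘ K♮ᴱ_j))` — the `j`-FREE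
scalar of `hH_unitK_comb`. -/
theorem regionSum_divV_unitStepMap (hrr : rr ∈ box (d + 1) Lc) (cE : ℝ) (j : ℕ) (hS : ∀ κ u x z a b, |S κ u x z a b| ≤ B)
    (T : Finset (Site (d + 1))) :
    ∑ Y ∈ T, divV (unitStepMap Lc (toSite rr) cE j S) Y
      = -((cE * (Lc : ℝ) ^ (2 * (d + 1)) * ((Lc : ℝ) ^ (d + 1))⁻¹) • mmRead Lc
          (comp (comp (unitK (sfStep Lc j) (smStep d Lc j) (coDressKBmAt (toSite rr) Lc (KInvStep (d := d) Lc j)))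
            (∑ u ∈ T.biUnion (fun Y => (box (d + 1) Lc).image (fun v => (Lc : ℤ) • Y + toSite v)), divV S u))
            (unitK (sfStep Lc j) (smStep d Lc j) (coDressKBmAt (toSite rr) Lc (KInvStep (d := d) Lc j))))) := by
  obtain ⟨δK, CK, hδK, -, hG⟩ := decays_coDressKBmAt_KInvStep (d := d) hrr j
  have e1 : ∑ Y ∈ T, divV (unitStepMap Lc (toSite rr) cE j S) Y
      = (cE * (Lc : ℝ) ^ (2 * (d + 1))) • ∑ Y ∈ T,
          divV (e3OfK Lc (unitK (sfStep Lc j) (smStep d Lc j) (coDressKBmAt (toSite rr) Lc (KInvStep (d := d) Lc j))) S) Y := by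
    rw [unitStepMap_eq_smul_e3OfK, Finset.smul_sum]
    exact Finset.sum_congr rfl fun Y _ => divV_smul_family _ _ Y
  rw [e1, regionSum_divV_e3OfK (decays_unitK hG) hδK (one_le_of_neZero Lc) hS (hH_unitK_comb hrr j) T, smul_neg, smul_smul]

/-- [folklore] **THE FLUX TOWER OF THE LITERAL's TRANSPORT IN UNITS** (the transport the (Q-R) END `WardRemainderEndThreeSplit` consumes; in-block root, bounded `S`,
any `cE`, every `m, k`, every finite `T`): `Σ_{Y ∈ T} divV (transport (unitStepMap Lc (toSite rr) cE) m k S) Y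
= transport (j V ↦ −((cE·Lc^{2(d+1)}·(Lc^{d+1})⁻¹) • mmRead Lc (K♮ᴱ_j ∘ V ∘ K♮ᴱ_j))) m k (Σ_{u ∈ U_{Lc^k}(T)} divV S u)` — per level ONE kernel sandwich and ONE
`j`-free scalar; the level enters only through `K♮ᴱ_j`. -/
theorem regionSum_divV_transport_unitStepMap (hrr : rr ∈ box (d + 1) Lc) (cE : ℝ) (hS : ∀ κ u x z a b, |S κ u x z a b| ≤ B)
    (m k : ℕ) (T : Finset (Site (d + 1))) :
    ∑ Y ∈ T, divV (transport (unitStepMap Lc (toSite rr) cE) m k S) Y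
      = transport (fun j V => -((cE * (Lc : ℝ) ^ (2 * (d + 1)) * ((Lc : ℝ) ^ (d + 1))⁻¹) • mmRead Lc
          (comp (comp (unitK (sfStep Lc j) (smStep d Lc j) (coDressKBmAt (toSite rr) Lc (KInvStep (d := d) Lc j))) V)
            (unitK (sfStep Lc j) (smStep d Lc j) (coDressKBmAt (toSite rr) Lc (KInvStep (d := d) Lc j)))))) m k
          (∑ u ∈ T.biUnion (fun Y => (box (d + 1) (Lc ^ k)).image (fun v => ((Lc ^ k : ℕ) : ℤ) • Y + toSite v)), divV S u) := by
  rw [unitStepMap_eq_smul_e3OfK]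
  have hK : ∀ j, ∃ δ C : ℝ, 0 < δ ∧ Decays (unitK (sfStep Lc j) (smStep d Lc j) (coDressKBmAt (toSite rr) Lc (KInvStep (d := d) Lc j))) C δ := by
    intro j
    obtain ⟨δK, CK, hδK, -, hG⟩ := decays_coDressKBmAt_KInvStep (d := d) hrr j
    exact ⟨δK, _, hδK, decays_unitK hG⟩
  exact regionSum_divV_transport_of_exists (c := fun _ => cE * (Lc : ℝ) ^ (2 * (d + 1))) (cH := fun _ => ((Lc : ℝ) ^ (d + 1))⁻¹)
    hK (one_le_of_neZero Lc) hS (fun j => hH_unitK_comb hrr j) m k T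

/-- [folklore] **THE FLUX TOWER OF THE LITERAL's NATIVE TRANSPORT** (`stepMap`: scalar `cE·wE (j+1)`, native constant `c_H(j) = (stepScale d Lc j · Lc^{d+1})⁻¹` of
d1-leaf-07's `colH_ward_KInvStep_all`; in-block root, bounded `S`, every `m, k, T`). -/
theorem regionSum_divV_transport_stepMap (hrr : rr ∈ box (d + 1) Lc) (cE : ℝ) (hS : ∀ κ u x z a b, |S κ u x z a b| ≤ B)
    (m k : ℕ) (T : Finset (Site (d + 1))) :
    ∑ Y ∈ T, divV (transport (stepMap Lc (toSite rr) cE) m k S) Y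
      = transport (fun j V => -((cE * wE d Lc (j + 1) * (stepScale d Lc j * (Lc : ℝ) ^ (d + 1))⁻¹) • mmRead Lc
          (comp (comp (coDressKBmAt (toSite rr) Lc (KInvStep (d := d) Lc j)) V) (coDressKBmAt (toSite rr) Lc (KInvStep (d := d) Lc j))))) m k
          (∑ u ∈ T.biUnion (fun Y => (box (d + 1) (Lc ^ k)).image (fun v => ((Lc ^ k : ℕ) : ℤ) • Y + toSite v)), divV S u) := by
  rw [stepMap_eq_smul_e3OfK]
  have hK : ∀ j, ∃ δ C : ℝ, 0 < δ ∧ Decays (coDressKBmAt (toSite rr) Lc (KInvStep (d := d) Lc j)) C δ := by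
    intro j
    obtain ⟨δK, CK, hδK, -, hG⟩ := decays_coDressKBmAt_KInvStep (d := d) hrr j
    exact ⟨δK, CK, hδK, hG⟩
  exact regionSum_divV_transport_of_exists (c := fun j => cE * wE d Lc (j + 1)) (cH := fun j => (stepScale d Lc j * (Lc : ℝ) ^ (d + 1))⁻¹)
    hK (one_le_of_neZero Lc) hS (fun j => colH_ward_KInvStep_all hrr j) m k T

/-- [folklore] **ONE LEVEL OF THE LITERAL's NATIVE TRANSPORT — THE FLUX RECURSION** (`stepMap`; in-block root, bounded `S`, any `cE`, every `j`, every finite `T`):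
`Σ_{Y ∈ T} divV (stepMap Lc (toSite rr) cE j S) Y = −((cE·wE (j+1)·(stepScale·Lc^{d+1})⁻¹) • mmRead Lc (Ĝ_j ∘ (Σ_{u ∈ U_{Lc}(T)} divV S u) ∘ Ĝ_j))`,
`Ĝ_j = coDressKBmAt (toSite rr) Lc (KInvStep Lc j)` (d1-leaf-07's `colH_ward_KInvStep_all` supplies the native `c_H(j)`). -/
theorem regionSum_divV_stepMap (hrr : rr ∈ box (d + 1) Lc) (cE : ℝ) (j : ℕ) (hS : ∀ κ u x z a b, |S κ u x z a b| ≤ B)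
    (T : Finset (Site (d + 1))) :
    ∑ Y ∈ T, divV (stepMap Lc (toSite rr) cE j S) Y
      = -((cE * wE d Lc (j + 1) * (stepScale d Lc j * (Lc : ℝ) ^ (d + 1))⁻¹) • mmRead Lc
          (comp (comp (coDressKBmAt (toSite rr) Lc (KInvStep (d := d) Lc j))
            (∑ u ∈ T.biUnion (fun Y => (box (d + 1) Lc).image (fun v => (Lc : ℤ) • Y + toSite v)), divV S u))
            (coDressKBmAt (toSite rr) Lc (KInvStep (d := d) Lc j)))) := by
  obtain ⟨δK, CK, hδK, -, hG⟩ := decays_coDressKBmAt_KInvStep (d := d) hrr j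
  have e1 : ∑ Y ∈ T, divV (stepMap Lc (toSite rr) cE j S) Y
      = (cE * wE d Lc (j + 1)) • ∑ Y ∈ T, divV (e3OfK Lc (coDressKBmAt (toSite rr) Lc (KInvStep (d := d) Lc j)) S) Y := by
    rw [stepMap_eq_smul_e3OfK, Finset.smul_sum]
    exact Finset.sum_congr rfl fun Y _ => divV_smul_family _ _ Y
  rw [e1, regionSum_divV_e3OfK hG hδK (one_le_of_neZero Lc) hS (colH_ward_KInvStep_all hrr j) T, smul_neg, smul_smul]

/-- [folklore] **THE (REP) REMAINDER's LETTER TOWER OBEYS THE AFFINE FLUX RECURSION** (the OWNER's (D) «`g^{(j+1)}(Y) = −c_H • mmRead(K_j ∘ Σ_{y∈B(Y)} g^{(j)}(y) ∘ K_j)·(units)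
+ divV σ_j(Y)`», for an2's born-sector remainder `bornSecAt` of `SrecWilsonSector ∕ SrecBornSector`, in-block root, every `j`, every finite `T`): the flux of member
`j+1` through `T` is the KERNEL-ONLY map of level `j` applied to member `j`'s flux through `U_{Lc}(T)`, PLUS the flux of the fresh sources `freshAt (j+1)` through `T`
(`bornSecAt_succ_eq`, `locStencil_bornSecAt` for the boundedness, `regionSum_divV_stepMap`, additivity of `divV`). -/
theorem regionSum_divV_bornSecAt_succ (hrr : rr ∈ box (d + 1) Lc) (cE cVH cΛ : ℝ) (j : ℕ) (T : Finset (Site (d + 1))) :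
    ∑ Y ∈ T, divV (bornSecAt Lc (toSite rr) cE cVH cΛ (j + 1)) Y
      = -((cE * wE d Lc (j + 1) * (stepScale d Lc j * (Lc : ℝ) ^ (d + 1))⁻¹) • mmRead Lc
          (comp (comp (coDressKBmAt (toSite rr) Lc (KInvStep (d := d) Lc j))
            (∑ u ∈ T.biUnion (fun Y => (box (d + 1) Lc).image (fun v => (Lc : ℤ) • Y + toSite v)),
              divV (bornSecAt Lc (toSite rr) cE cVH cΛ j) u))
            (coDressKBmAt (toSite rr) Lc (KInvStep (d := d) Lc j))))
        + ∑ Y ∈ T, divV (freshAt Lc (toSite rr) cVH cΛ (j + 1)) Y := by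
  obtain ⟨Cs, δs, hδs, hSl⟩ := locStencil_bornSecAt hrr cE cVH cΛ j
  have hS : ∀ κ u x z a b, |bornSecAt Lc (toSite rr) cE cVH cΛ j κ u x z a b| ≤ Cs :=
    fun κ u x z a b => abs_le_of_locStencil hSl hδs.le κ u x z a b
  rw [bornSecAt_succ_eq hrr cE cVH cΛ j, ← regionSum_divV_stepMap hrr cE j hS T, ← Finset.sum_add_distrib]
  exact Finset.sum_congr rfl fun Y _ =>
    (divV_add (stepMap Lc (toSite rr) cE j (bornSecAt Lc (toSite rr) cE cVH cΛ j)) (freshAt Lc (toSite rr) cVH cΛ (j + 1)) Y :)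

end Literal

end Summit.QuantumFields.BalabanUV.Beta.GAN24.BlockFluxTower

end
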